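import Summits.ResolutionOfSingularities.ResolutionOfSingularities.Theorems.HilbertSamuelEliminationCampaignW42Ridge
import Summits.ResolutionOfSingularities.ResolutionOfSingularities.Theorems.HilbertSamuelEliminationCampaignW42NearAlignment
import Literature.AlgebraicGeometry.Resolution.NearPointRidgeDietel
import Literature.AlgebraicGeometry.Resolution.SigmaMaxEliminationInDim
import Literature.AlgebraicGeometry.Resolution.CofinalityFromPrincipalization
import Literature.AlgebraicGeometry.Resolution.ExcellentRingsFieldProofs
import HarnessLib

/-!
# [OURS · L1 W4.2] Dietel bridges for the ridge statements of campaign s42 / chain w42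
# (crux `SigmaMaxModifications` stmt-ResolutionOfSingularities-18506, conjunct stmt-19249; informal support
# item `RidgeConfinement` stmt-17845) — OBJECT «NEAR-ALIGNMENT + DIETEL BRIDGES» of res-L1-w42-plan-1
# RULINGS v3.10-3 (2026-08-27) and director-resolution RE-KEY (2026-08-27), cell res-hironaka, rung L

HONEST FRAMING. This is an OURS proof file of slot W4.2 (typed and proved by res-L1-type-o1): it DERIVES the
campaign statements of `HilbertSamuelEliminationCampaignW42Ridge.lean` (`CampaignW42.RidgeDimEqDirDimOfPerfect`,
and — appended below when it closes — `CampaignW42.RidgeDimMonotone`) from the NAMED LITERATURE FACTS of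
`Literature/AlgebraicGeometry/Resolution/NearPointRidgeDietel.lean` (B. Dietel, Dissertation Regensburg 2014/2015,
THESIS-flagged source admitted by the FACT desk: `Dietel2015_ridge_perfect` = Lemma (6.3.5) (ii) p. 76 [F-56],
`Dietel2015_nearPoint_ridge` = Thm. (8.2.7) (ii) p. 105 [F-54]), taken BY NAME AS HYPOTHESES — nothing is restated,
nothing is asserted unconditionally about resolution of singularities, and NOTHING here is a statement of
H. Hironaka's manuscript [Hironaka2017]. The file is FACT-FREE (no new `def … : Prop`), kernel-checked, and every
theorem is CONDITIONAL on the cited facts exactly as printed in its signature. AI-produced; weaker than expert review.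

CONSEQUENCE FOR THE RECORD (director-resolution RE-KEY 2026-08-27 (2)): the sentence «only sketched in print (CPSc
2017, Schober 2021)» in the docstring of `CampaignW42.RidgeDimMonotone` (file …CampaignW42Ridge.lean, p465459) is
OUTDATED as of 2026-08-27: Dietel 2015, Thm. (8.2.7) (ii), pp. 97–106, prints a full proof of the ridge-dimension
drop at near points in every characteristic (typed as F-54); the campaign statements `RidgeDimMonotone` /
`RidgeDimEqDirDimOfPerfect` are therefore RETIRED AS PROOF OBLIGATIONS and replaced by the bridge corollaries of
this file (the informal item stmt-17845 stays informal support by design, RULINGS v3.10-3 (b)).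

## Contents (v1 p510729: the sanity rung (b2); v2: the monotonicity bridge (b1) appended — append-only protocol, v1
## declarations byte-identical; the near-point alignment (AL) it rests on is the companion file
## `HilbertSamuelEliminationCampaignW42NearAlignment.lean`, `CampaignW42.exists_trdeg_hilbertSamuelFun_eq_of_hsFun_eq`)

* `CampaignW42.ridgeDimEqDirDimOfPerfect_of_dietel` — **(b2)** `Dietel2015_ridge_perfect → ∀ p,
  RidgeDimEqDirDimOfPerfect p`: at a point `x` with PERFECT residue field `κ(x)`, `dim F_x(X) = e_x(X)`. Proof:
  `Scheme.ridgeDim X x = ridgeDim J` and `Scheme.dirDim X x = directrixDim J` for the canonical tangent-cone ideal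
  `J = canonicalTangentConeIdeal 𝒪_{X,x} ⊆ κ(x)[X_1, …, X_e]` (tree `RidgeLocal.lean`, `DirectrixLocal.lean`), `J`
  is homogeneous (`isHomogeneousIdeal_tangentConeIdeal`), and F-56 at `k = K = κ(x)` gives
  `ridgeDim J = directrixDim (J · κ(x)[X]) = directrixDim J` (`coneIdeal κ(x) J = J` by `MvPolynomial.map_id`).
  The scheme hypotheses of `RidgeDimEqDirDimOfPerfect` (finite type, reduced, separated, characteristic `p`) are
  not used: F-56 is a statement about cones over an arbitrary field.

* **(b1)** `CampaignW42.ridgeDimMonotone_of_dietel` — `Dietel2015_nearPoint_ridge → ∀ p, RidgeDimMonotone p`: the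
  MONOTONICITY INEQUALITY `dim F_{x'}(X') + tr.deg(κ(x')/κ(x)) ≤ dim F_x(X)` at CJS-near points of permissible
  blow-ups of reduced separated schemes of finite type over a field of characteristic `p` (`CampaignW42.RidgeDimDropAt`,
  in `Cardinal`), from F-54 (a hypothesis) through the alignment (AL): `X` is excellent
  (`Scheme.IsExcellent.of_locallyOfFiniteType` over `Spec k`, `isExcellentRing_of_field`), so `𝒪_{X,π x'}` is
  universally catenary; `IsPermissible D` gives `IsPermissibleAt D (π x')`; (AL) turns `hsFun`-nearness at level `N`
  into `tr.deg = d` and `H^{(d+1)}[𝒪_{X',x'}] = H^{(1)}[𝒪_{X,π x'}]`; F-54's conclusion (8.2.7.B)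
  `dim F_{x'}(X') + d ≤ dim F_{π x'}(X)` in `ℕ` is cast to `Cardinal` along `tr.deg = d`.

* **(b2♮)** `CampaignW42.ridgeDimEqDirDimOfPerfect_holds : ∀ p, RidgeDimEqDirDimOfPerfect p` — UNCONDITIONAL, by
  (b2) and the tree's discharge `Dietel2015_ridge_perfect_holds` of F-56 (res-lit-4, 2026-08-27).

VACUITY / STRENGTH. `RidgeDimEqDirDimOfPerfect p` is not vacuous (closed points of varieties over perfect fields)
and fails without perfectness (Hironaka's quadric, `e_x = 0 < dim F_x`); the bridge shows it is EXACTLY the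
scheme-level shadow of Dietel's Lemma (6.3.5) (ii) with `K = k`. No strengthening is claimed.
`RidgeDimMonotone p` is not vacuous (near points over permissible centres exist, e.g. on the blown-up Hironaka quadric of
`Literature.Barriers.ResolutionOfSingularities.DirectrixSmallCharacteristic`) and is now EXACTLY (8.2.7.B) of Dietel's
Thm. (8.2.7) (ii) read at CJS-near points; the confinement clause of F-54 (`dim 𝒪_{D,x} < dim F_x(X)`) is not consumed
here (it belongs to the informal item stmt-17845's first half, which stays informal support by design).

## References

* B. Dietel, *A refinement of Hironaka's additive group schemes for an extended invariant*, Dissertation,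
  Universität Regensburg (2014/2015), Lemma (6.3.5) (ii) p. 76, Thm. (8.2.7) (ii) p. 105. [Dietel2015]
* V. Cossart, U. Jannsen, S. Saito, LNM 2270 (2020), Def. 2.18, Def. 2.28, Thm. 3.10, Rem. 18.29.
  [CossartJannsenSaito2020]
* J. Giraud, Ann. Sci. ÉNS (4) 8 (1975), §1.5, §3.3.1. [Giraud1975]
* Cell res-hironaka: res-L1-w42-plan-1 RULINGS v3.10-3 (2026-08-27T07:03:59Z); director-resolution RE-KEY of
  stmt-17845 (2026-08-27T07:12:58Z); FACT-LIST rows F-54 / F-56 (res-dag-4).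
-/

noncomputable section

set_option linter.dupNamespace false -- mandated namespace of this single-conjunct summit

open CategoryTheory AlgebraicGeometry TopologicalSpace IsLocalRing
open Literature.RingTheory.HilbertSamuel Literature.RingTheory.MvPolynomial
open Literature.AlgebraicGeometry.Resolution

namespace Summit.ResolutionOfSingularities.ResolutionOfSingularities.Theorems

namespace CampaignW42

universe u

/-! ## (b2) The sanity rung from Dietel's Lemma (6.3.5) (ii) -/

/-- [OURS · L1 W4.2] local form of the sanity rung: for a noetherian local ring `A` with PERFECT residue field `k`,
Dietel's Lemma (6.3.5) (ii) (named fact `Dietel2015_ridge_perfect`, F-56, taken as a hypothesis) gives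
`dim F(A) = e(A)` — the ridge of the tangent cone and its directrix have the same dimension (`localRidgeDim A =
dirDim A`; both are computed from the homogeneous ideal `J = canonicalTangentConeIdeal A ⊆ k[X_1, …, X_e]`, and
`J · k[X] = J`). NOT a statement of the manuscript [Hironaka2017]; conditional on the cited fact.
[cite: Dietel2015, Lemma (6.3.5) (ii) p. 76] -/
theorem localRidgeDim_eq_dirDim_of_dietel (h56 : Dietel2015_ridge_perfect.{u}) (A : Type u) [CommRing A]
    [IsLocalRing A] [IsNoetherianRing A] (hperf : PerfectField (ResidueField A)) :
    localRidgeDim A = dirDim A := by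
  have hJ : IsHomogeneousIdeal (canonicalTangentConeIdeal A) :=
    isHomogeneousIdeal_tangentConeIdeal _ _
  obtain ⟨-, h⟩ := h56 (ResidueField A) (maximalIdeal A).spanFinrank (canonicalTangentConeIdeal A) hJ
    (ResidueField A) hperf
  have hid : (MvPolynomial.map (RingHom.id (ResidueField A)) :
      MvPolynomial (Fin (maximalIdeal A).spanFinrank) (ResidueField A) →+*
        MvPolynomial (Fin (maximalIdeal A).spanFinrank) (ResidueField A)) = RingHom.id _ :=
    RingHom.ext fun q => MvPolynomial.map_id q
  rw [localRidgeDim_eq, h, coneIdeal, Algebra.algebraMap_self, hid, Ideal.map_id]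
  rfl

/-- [OURS · L1 W4.2] **(b2) the Dietel bridge for the sanity rung**: `Dietel2015_ridge_perfect → ∀ p,
RidgeDimEqDirDimOfPerfect p` — Dietel's Lemma (6.3.5) (ii) (F-56, a hypothesis) yields the campaign statement
`CampaignW42.RidgeDimEqDirDimOfPerfect p` (file …CampaignW42Ridge.lean, p465459) for every `p`: at every point `x`
of a reduced separated scheme of finite type over a field of characteristic `p` whose residue field `κ(x)` is
perfect, `dim F_x(X) = e_x(X)` (`Scheme.ridgeDim X x = Scheme.dirDim X x`). The scheme-theoretic hypotheses are not
used (F-56 is a statement about cones over any field); replaces the role of the route-file remark «Rid_red = Dir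
over perfect residue fields» of the informal item stmt-ResolutionOfSingularities-17845 as a PROOF OBLIGATION
(RULINGS v3.10-3: retired, bridged to print). NOT a statement of the manuscript [Hironaka2017]; conditional on the
cited fact, nothing else. [cite: Dietel2015, Lemma (6.3.5) (ii) p. 76] -/
theorem ridgeDimEqDirDimOfPerfect_of_dietel (h56 : Dietel2015_ridge_perfect.{u}) (p : ℕ) :
    RidgeDimEqDirDimOfPerfect.{u} p := by
  intro k _ _ X _ f _ _ _ _ x hperf
  exact localRidgeDim_eq_dirDim_of_dietel h56 (X.presheaf.stalk x) hperf

/-! ## (b1) The Dietel bridge for the monotonicity inequality -/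

/-- [OURS · L1 W4.2] **(b1) the Dietel bridge for the monotonicity inequality**: `Dietel2015_nearPoint_ridge → ∀ p,
RidgeDimMonotone p` — Dietel's Thm. (8.2.7) (ii) (F-54, `Literature/…/NearPointRidgeDietel.lean`, taken BY NAME as a
hypothesis) yields the campaign statement `CampaignW42.RidgeDimMonotone p` (file …CampaignW42Ridge.lean, p465459)
for every `p`: for a reduced separated scheme `X` of finite type over a field `k` of characteristic `p`, a permissible
centre `D` (CJS Def. 3.1), a blow-up `π : X' → X` along `D`, `N ≥ dim X` and a point `x'` over `V(D)` that is CJS-near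
to `π x'` at level `N`, one has `dim F_{x'}(X') + tr.deg(κ(x')/κ(π x')) ≤ dim F_{π x'}(X)` (`RidgeDimDropAt π x'`).
Proof: `X` is excellent (`Scheme.IsExcellent.of_locallyOfFiniteType` over `Spec k`, `isExcellentRing_of_field`,
`Scheme.isExcellent_Spec_of_isExcellentRing`), so `𝒪_{X,π x'}` is universally catenary; (AL) converts nearness into
`tr.deg = d` and `H^{(d+1)}[𝒪_{X',x'}] = H^{(1)}[𝒪_{X,π x'}]`; F-54 (8.2.7.B) gives `dim F_{x'}(X') + d ≤ dim F_{π x'}(X)`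
in `ℕ`, cast to `Cardinal`. This REPLACES `RidgeDimMonotone` AS A PROOF OBLIGATION of the informal item
stmt-ResolutionOfSingularities-17845 (director-resolution RE-KEY 2026-08-27: retired, bridged to print; the W42Ridge
docstring's «only sketched in print» is outdated — Dietel 2015 pp. 97–106). NOT a statement of the manuscript
[Hironaka2017]; conditional on the cited fact exactly as its signature says, nothing else.
[cite: Dietel2015, Thm. (8.2.7) (ii) p. 105] [cite: CossartJannsenSaito2020, Thm. 3.10, Rem. 18.29 (1)] -/
theorem ridgeDimMonotone_of_dietel (h54 : Dietel2015_nearPoint_ridge.{u}) (p : ℕ) :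
    RidgeDimMonotone.{u} p := by
  intro k _ _ X _ f _ hft _ _ D hD X' _ π hπ N _ x' hx hnear
  have hexc : Scheme.IsExcellent X :=
    Scheme.IsExcellent.of_locallyOfFiniteType f
      (Scheme.isExcellent_Spec_of_isExcellentRing k (isExcellentRing_of_field k))
  obtain ⟨d, hd, -, hH⟩ := exists_trdeg_hilbertSamuelFun_eq_of_hsFun_eq hπ x' (hD _ hx)
    (hexc.isUniversallyCatenaryRing_stalk _) N hnear
  obtain ⟨hB, -⟩ := h54 X X' π D hπ x' hx (hD _ hx) d hd hH
  have hd' : @Algebra.trdeg (X.residueField (π.base x')) (X'.residueField x') _ _ (residueAlgebra π x') =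
      (d : Cardinal.{u}) := hd
  show (Scheme.ridgeDim X' x' : Cardinal.{u}) +
      @Algebra.trdeg (X.residueField (π.base x')) (X'.residueField x') _ _ (residueAlgebra π x') ≤
    (Scheme.ridgeDim X (π.base x') : Cardinal.{u})
  rw [hd']
  exact_mod_cast hB

/-! ## (b2♮) The sanity rung, unconditionally (F-56 is discharged in the tree) -/

/-- [OURS · L1 W4.2] **the sanity rung holds outright**: `∀ p, RidgeDimEqDirDimOfPerfect p` — at every point with
perfect residue field of a reduced separated scheme of finite type over a field of characteristic `p`,
`dim F_x(X) = e_x(X)`. Unconditional: the bridge `ridgeDimEqDirDimOfPerfect_of_dietel` (v1, p510729) fed with the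
tree's DISCHARGE `Dietel2015_ridge_perfect_holds` of F-56 (res-lit-4, `RidgePerfectField.lean` /
`NearPointRidgeDietel.lean`: Dietel's Lemma (6.3.5) (ii) PROVED on Giraud's structure theory). This CLOSES the OURS
campaign decl `CampaignW42.RidgeDimEqDirDimOfPerfect` (file …CampaignW42Ridge.lean, p465459) by name, for every `p`.
NOT a statement of the manuscript [Hironaka2017]. [cite: Dietel2015, Lemma (6.3.5) (ii) p. 76] -/
theorem ridgeDimEqDirDimOfPerfect_holds (p : ℕ) : RidgeDimEqDirDimOfPerfect.{u} p :=
  ridgeDimEqDirDimOfPerfect_of_dietel Dietel2015_ridge_perfect_holds p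

end CampaignW42

end Summit.ResolutionOfSingularities.ResolutionOfSingularities.Theorems

end
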